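import Summits.CriticalPhenomena.PercolationContinuityZ3.Theorems.PercNearOneGluingNoHeavyLowerTailSunflowerTBernHubPackH
import HarnessLib

/-!
# `NoHeavyLowerTail` (crux stmt-CriticalPhenomena-4575), abstract sunflower cubic: T-BERN — the scalar core of the endgame with a
# LEVERAGED last petal: (HCᵣ) from (HC) by affine interpolation, and ★ᵣ from (HCᵣ)

Support file (seat `prim-ineq-prove-1` gen 65; `--supports stmt-CriticalPhenomena-4575`).  No `sorry`, no named facts.
Memo: run/shared/lean/prim/prim-ineq-prove-1/FINDING-REDUCTION-prove1-g65.md §2.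

`…SunflowerTBernHubPackH` certifies {hub `P`, sub-dwarf pack `Q`, h-petal `(b, vv_h, b)`}: the pack is absorbed into the hub
exactly (`zone_extend_flex`) and the h-petal is the last step ★, reduced to the scalar condition (HC) (`star_of_hc`,
`hc_pack`).  When the last petal is ANY tight leveraged petal `r` — normalised `r = (w, z, w)` with `1 ≤ w ≤ z`,
`α_r = 1 + κ(w−1)`, `γ_r = λw + μz` (the h-petal is `w = 1`) — the last step reads
  ★ᵣ  `A·γ_r + G·α_r ≤ ᾱ + Y`
for the state `(A, G)` of {hub, pack}.  **`star_r_of_hcr`**: by the convex combination of the two lower bounds `Y ≥ Gγ_r`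
(g-budget) and `Y ≥ γ_D z_P·z` (vv-budget) with weight `τ = μ(A−G)/(gz−μG)` on the second (which cancels the `z`-terms
exactly), ★ᵣ follows from the scalar condition
  (HCᵣ)  `λ·gz·w·(A − G) ≤ (gz − μG)(ᾱ − G·α_r)`,   `gz = γ_D z_P`,   in the regime `gz < G < A`
(for `w = 1` this is (HC) in the form `phiHC ≥ 0`).  **`hcr_of_hc`**: (HCᵣ) follows from (HC) (`hc_pack`) by AFFINE
INTERPOLATION: along the line `x_P(w′)·w′ = x_P·w` (total x-mass of hub and last petal fixed) the quantity
`F(w′) = (gz − μG)(ᾱ − Gα(w′)) − λ·gz·w′·(A(x_P(w′)) − G)` is affine in `w′`; `F(1)` is the (HC) quantity of the hub `x_P·w`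
(nonnegative by `hc_pack`), and at the root `w* > w` of the affine `w′(A(x_P(w′)) − G)` one has `F(w*) = (gz − μG)(ᾱ − Gα(w*)) ≥ 0`
because the exact state never exceeds `α` of the absorbed x-mass (**`packA_le_alpha`**), so `Gα(w*) = A(x*)α(w*) ≤ α(x*X_Q w*) ≤ ᾱ`.
The assembled certificate is `domOn_hub_pack_lev` (`…SunflowerTBernT2Lev`).
-/

noncomputable section

namespace Summit.CriticalPhenomena.PercolationContinuityZ3.Theorems.SunflowerPartition

namespace SafeCalc

namespace LinkedCurrency

open Finset Polynomial

variable {ι : Type*}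

/-! ## Scalar lemmas -/

/-- **The exact state never exceeds `α` of the absorbed x-mass**: for a tight sub-dwarf pack `W` and any `x ≥ 1`, `γ_P ≥ 1`,
`packG·α(x) − γ_P·packG·packS ≤ α(x·∏(1+ξ_j))`. [this work] -/
theorem packA_le_alpha [DecidableEq ι] {κ lam : ℝ} (hκ0 : 0 ≤ κ) (hκl : κ ≤ lam) (hl1 : lam ≤ 1) {x γP : ℝ}
    (hx : 1 ≤ x) (hγP : 1 ≤ γP) :
    ∀ (W : Finset ι) (ξ : ι → ℝ), (∀ j ∈ W, 0 ≤ ξ j) →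
      packG lam W ξ * (1 + κ * (x - 1)) - γP * packG lam W ξ * packS κ lam W ξ ≤
        1 + κ * (x * ∏ j ∈ W, (1 + ξ j) - 1) := by
  intro W
  induction W using Finset.induction_on with
  | empty =>
    intro ξ _
    simp only [packG, packS, prod_empty, sum_empty, mul_zero, sub_zero, one_mul, mul_one]
    exact le_rfl
  | @insert j W hjW ih =>
    intro ξ hξ0
    have hl : 0 ≤ lam := hκ0.trans hκl
    have he0 : 0 ≤ ξ j := hξ0 j (mem_insert_self j W)
    have hξ0W : ∀ i ∈ W, 0 ≤ ξ i := fun i hi => hξ0 i (mem_insert_of_mem hi)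
    have key := ih ξ hξ0W
    set g := packG lam W ξ with hg
    set σ := packS κ lam W ξ with hσ
    set XW := x * ∏ i ∈ W, (1 + ξ i) with hXW
    have hg1 : 1 ≤ g := one_le_packG hl W hξ0W
    have hXW1 : 1 ≤ XW := by
      have : 1 ≤ ∏ i ∈ W, (1 + ξ i) := Pendant.one_le_prod_of_one_le W fun i hi => by linarith [hξ0W i hi]
      exact one_le_mul_of_one_le_of_one_le hx this
    have hγe : 0 < 1 + lam * ξ j := by have := mul_nonneg hl he0; linarith
    have hG : packG lam (insert j W) ξ = (1 + lam * ξ j) * g := by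
      rw [hg]; simp only [packG]; rw [prod_insert hjW]
    have hS : packS κ lam (insert j W) ξ = (lam - κ) * ξ j / (1 + lam * ξ j) + σ := by
      rw [hσ]; simp only [packS]; rw [sum_insert hjW]
    have hX : x * ∏ i ∈ insert j W, (1 + ξ i) = XW * (1 + ξ j) := by
      rw [prod_insert hjW]; ring
    rw [hG, hS, hX]
    have hGW1 : 1 ≤ γP * g := one_le_mul_of_one_le_of_one_le hγP hg1
    have hstep := xstep_le (X := XW) (x := 1 + ξ j) (γ := 1 + lam * ξ j) (G := γP * g) hκ0 hXW1 hGW1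
      (by have := mul_le_mul_of_nonneg_right hκl he0; linarith)
      (by have := mul_le_mul_of_nonneg_right hl1 he0; linarith)
    have e1 : (1 + lam * ξ j) * g * (1 + κ * (x - 1)) -
        γP * ((1 + lam * ξ j) * g) * ((lam - κ) * ξ j / (1 + lam * ξ j) + σ) =
        (1 + lam * ξ j) * (g * (1 + κ * (x - 1)) - γP * g * σ) - γP * g * ((lam - κ) * ξ j) := by
      field_simp
      ring
    rw [e1]
    have h1 : (1 + lam * ξ j) * (g * (1 + κ * (x - 1)) - γP * g * σ) ≤ (1 + lam * ξ j) * (1 + κ * (XW - 1)) :=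
      mul_le_mul_of_nonneg_left key hγe.le
    have e2 : (lam - κ) * ξ j = (1 + lam * ξ j) - (1 + κ * (1 + ξ j - 1)) := by ring
    rw [e2]
    linarith [hstep, h1]

/-- **(HCᵣ) from (HC) by affine interpolation.**  Normalised setting of `hc_pack` (`0 ≤ κ ≤ λ ≤ 1`, `μ = 1−λ`, `D ≥ 1`,
`K ≥ 0`, `ᾱ = (1−κ)+K`, `μᾱ = (1−κ)γ_D`); hub `(x_P, z_P, w_P)`, tight pack `W`, and a last petal of x-size `w ≥ 1` sharing
the x-budget: `κ·x_P·w·∏(1+ξ_j) ≤ K`.  State `G = γ_P·packG`, `A = packG·α(x_P) − G·packS`, `gz = γ_D z_P`.  Then in the regime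
`gz < G < A`:  `λ·gz·w·(A − G) ≤ (gz − μG)(ᾱ − G·(1 + κ(w−1)))`. [this work] -/
theorem hcr_of_hc [DecidableEq ι] {κ lam μ D K abar xP zP wP w A G : ℝ} (hκ0 : 0 ≤ κ) (hκl : κ ≤ lam)
    (hl1 : lam ≤ 1) (hμ : μ = 1 - lam) (hD : 1 ≤ D) (hK0 : 0 ≤ K) (habar : abar = (1 - κ) + K)
    (hI : μ * abar = (1 - κ) * (lam * D + μ)) (W : Finset ι) {ξ : ι → ℝ} (hξ0 : ∀ j ∈ W, 0 ≤ ξ j)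
    (hξD : ∀ j ∈ W, ξ j ≤ D - 1) (hz : 1 ≤ zP) (hw1 : 1 ≤ wP) (hwx : wP ≤ xP) (hwD : wP ≤ D * zP) (hw : 1 ≤ w)
    (hbud : κ * (xP * w) * ∏ j ∈ W, (1 + ξ j) ≤ K)
    (hG : G = (lam * wP + μ * zP) * packG lam W ξ)
    (hA : A = packG lam W ξ * (1 + κ * (xP - 1)) - G * packS κ lam W ξ) :
    (lam * D + μ) * zP < G → G < A →
      lam * ((lam * D + μ) * zP) * w * (A - G) ≤
        ((lam * D + μ) * zP - μ * G) * (abar - G * (1 + κ * (w - 1))) := by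
  intro hrelG hrelA
  have hl : 0 ≤ lam := hκ0.trans hκl
  have hμ0 : 0 ≤ μ := by rw [hμ]; linarith
  have hxP : 1 ≤ xP := hw1.trans hwx
  set γD := lam * D + μ with hγDdef
  set γP := lam * wP + μ * zP with hγP
  set g := packG lam W ξ with hg
  set σ := packS κ lam W ξ with hσ
  set XQ := ∏ j ∈ W, (1 + ξ j) with hXQ
  set gz := γD * zP with hgzdef
  have hγD1 : 1 ≤ γD := by rw [hγDdef, hμ]; linarith [mul_le_mul_of_nonneg_left hD hl]
  have hg1 : 1 ≤ g := one_le_packG hl W hξ0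
  have hg0 : 0 < g := by linarith
  have hσ0 : 0 ≤ σ := packS_nonneg hκl hl W hξ0
  have hXQ1 : 1 ≤ XQ := Pendant.one_le_prod_of_one_le W fun i hi => by linarith [hξ0 i hi]
  have hγP1 : 1 ≤ γP := by
    have h1 : lam * 1 ≤ lam * wP := mul_le_mul_of_nonneg_left hw1 hl
    have h2 : μ * 1 ≤ μ * zP := mul_le_mul_of_nonneg_left hz hμ0
    rw [hγP, hμ] at *; linarith
  have hG1 : 1 ≤ G := by rw [hG]; exact one_le_mul_of_one_le_of_one_le hγP1 hg1
  have hG0 : 0 < G := by linarith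
  have hgz1 : 1 ≤ gz := by rw [hgzdef]; exact one_le_mul_of_one_le_of_one_le hγD1 hz
  -- the x-budget in `α`-form
  have hαbud : 1 + κ * (xP * w * XQ - 1) ≤ abar := by
    have e : κ * (xP * w * XQ - 1) = κ * (xP * w) * XQ - κ := by ring
    rw [habar, e]; linarith
  -- the hub `x_P·w` and its state `A₁`
  set A₁ := g * (1 + κ * (xP * w - 1)) - G * σ with hA₁
  have hA₁A : A ≤ A₁ := by
    have e : A₁ - A = g * κ * (xP * (w - 1)) := by rw [hA, hA₁]; ring
    have : 0 ≤ g * κ * (xP * (w - 1)) :=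
      mul_nonneg (mul_nonneg hg0.le hκ0) (mul_nonneg (by linarith) (sub_nonneg.2 hw))
    linarith
  have hA₁le : A₁ ≤ 1 + κ * (xP * w * XQ - 1) := by
    have := packA_le_alpha hκ0 hκl hl1 (x := xP * w) (γP := γP) (one_le_mul_of_one_le_of_one_le hxP hw) hγP1 W ξ hξ0
    rw [hA₁, hG]; rw [← hg, ← hσ, ← hXQ] at this
    linarith
  have hA₁abar : A₁ ≤ abar := hA₁le.trans hαbud
  -- (HC) for the hub `x_P·w` (legitimate: `w_P ≤ x_P ≤ x_P w`)
  have hHC := hc_pack hκ0 hκl hl1 hμ hD hK0 habar hI W hξ0 hξD hz hw1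
    (hwx.trans (le_mul_of_one_le_right (by linarith) hw)) hwD hbud hG
    (show A₁ = packG lam W ξ * (1 + κ * (xP * w - 1)) - G * packS κ lam W ξ by rw [hA₁]) hA₁abar hrelG
    (lt_of_lt_of_le hrelA hA₁A)
  rw [← hγDdef, ← hgzdef] at hHC
  -- in `F`-form: F(1) ≥ 0
  have hF1 : 0 ≤ (gz - μ * G) * (abar - G) - lam * gz * (A₁ - G) := by
    have e : (gz - μ * G) * (abar - G) - lam * gz * (A₁ - G) =
        (abar - A₁) * (gz - μ * G) - μ * (A₁ - G) * (G - gz) := by rw [hμ]; ring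
    rw [e]; linarith
  -- the affine functions `L(w') = q − m w'` (`= w'(A(x_P w/w') − G)`) and `F(w')`
  set q := g * κ * (xP * w) with hq
  set m := G * (1 + σ) - g * (1 - κ) with hm
  have hLw : w * (A - G) = q - m * w := by rw [hA, hq, hm]; ring
  have hL1 : A₁ - G = q - m * 1 := by rw [hA₁, hq, hm]; ring
  -- at `w_end = x_P w / w_P` the hub would be tight, where `A ≤ G`: `L(w_end) ≤ 0`
  have hwP0 : 0 < wP := by linarith
  set wend := xP * w / wP with hwend
  have hwend_ge : w ≤ wend := by
    rw [hwend, le_div_iff₀ hwP0]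
    calc w * wP ≤ w * xP := mul_le_mul_of_nonneg_left hwx (by linarith)
      _ = xP * w := mul_comm _ _
  have hLend : q - m * wend ≤ 0 := by
    -- q − m·wend = wend·(g α(w_P) − Gσ − G) and g α(w_P) ≤ γ_P g = G
    have e : q - m * wend = wend * (g * (1 + κ * (wP - 1)) - G * σ - G) := by
      rw [hq, hm, hwend]; field_simp; ring
    have hαγ : 1 + κ * (wP - 1) ≤ γP := by
      have h1 := alpha_le_gamma hκl hw1
      have h2 : 1 + lam * (wP - 1) ≤ lam * wP + μ * zP := by
        have := mul_nonneg hμ0 (sub_nonneg.2 hz); linarith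
      exact h1.trans h2
    have h3 : g * (1 + κ * (wP - 1)) ≤ G := by rw [hG]; linarith [mul_le_mul_of_nonneg_right hαγ hg0.le]
    have hwend0 : 0 ≤ wend := by rw [hwend]; positivity
    rw [e]
    exact mul_nonpos_of_nonneg_of_nonpos hwend0 (by linarith [mul_nonneg hG0.le hσ0])
  have hLw_pos : 0 < q - m * w := by rw [← hLw]; exact mul_pos (by linarith) (by linarith)
  have hm0 : 0 < m := by
    have e1 : m * (wend - w) = (q - m * w) - (q - m * wend) := by ring
    have h1 : 0 < m * (wend - w) := by rw [e1]; linarith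
    by_contra h
    push Not at h
    have : m * (wend - w) ≤ 0 := mul_nonpos_of_nonpos_of_nonneg h (sub_nonneg.2 hwend_ge)
    linarith
  -- the root `w*` of `L`
  set ws := q / m with hws
  have hws_w : w < ws := by rw [hws, lt_div_iff₀ hm0]; linarith
  have hws1 : 1 < ws := lt_of_le_of_lt hw hws_w
  have hws_end : ws ≤ wend := by rw [hws, div_le_iff₀ hm0]; linarith
  have hws0 : 0 < ws := by linarith
  -- at `w*`: the hub `x* = x_P w / w*` has `A(x*) = G`, and `G α(w*) ≤ α(x_P w X_Q) ≤ ᾱ`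
  set xs := xP * w / ws with hxs
  have hxs1 : 1 ≤ xs := by
    rw [hxs, le_div_iff₀ hws0]
    have h1 : ws * wP ≤ xP * w := by rwa [hwend, le_div_iff₀ hwP0] at hws_end
    have h2 : ws * 1 ≤ ws * wP := mul_le_mul_of_nonneg_left hw1 hws0.le
    linarith
  have h0 : q - m * ws = 0 := by rw [hws, mul_div_cancel₀ _ hm0.ne', sub_self]
  have hAxs : g * (1 + κ * (xs - 1)) - G * σ = G := by
    -- ws · (A(xs) − G) = q − m ws = 0
    have e : ws * (g * (1 + κ * (xs - 1)) - G * σ - G) = q - m * ws := by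
      rw [hxs, hq, hm]; field_simp; ring
    rw [h0] at e
    have := (mul_eq_zero.1 e).resolve_left hws0.ne'
    linarith
  have hGαs : G * (1 + κ * (ws - 1)) ≤ abar := by
    have h1 : g * (1 + κ * (xs - 1)) - γP * g * σ ≤ 1 + κ * (xs * XQ - 1) :=
      packA_le_alpha hκ0 hκl hl1 hxs1 hγP1 W ξ hξ0
    have h2 : G ≤ 1 + κ * (xs * XQ - 1) := by
      have e : γP * g * σ = G * σ := by rw [hG]
      rw [e] at h1; linarith
    have h3 : (1 + κ * (xs * XQ - 1)) * (1 + κ * (ws - 1)) ≤ 1 + κ * (xs * XQ * ws - 1) :=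
      alpha_mul_le hκ0 (hκl.trans hl1) (one_le_mul_of_one_le_of_one_le hxs1 hXQ1) hws1.le
    have h4 : xs * XQ * ws = xP * w * XQ := by
      rw [hxs, div_mul_eq_mul_div, div_mul_eq_mul_div, div_eq_iff hws0.ne']
    have hαs0 : 0 ≤ 1 + κ * (ws - 1) := by
      have := mul_nonneg hκ0 (sub_nonneg.2 hws1.le); linarith
    calc G * (1 + κ * (ws - 1)) ≤ (1 + κ * (xs * XQ - 1)) * (1 + κ * (ws - 1)) :=
          mul_le_mul_of_nonneg_right h2 hαs0
      _ ≤ 1 + κ * (xs * XQ * ws - 1) := h3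
      _ = 1 + κ * (xP * w * XQ - 1) := by rw [h4]
      _ ≤ abar := hαbud
  -- `gz − μG ≥ 0`
  have hgzμG : 0 ≤ gz - μ * G := by
    have h1 : μ * G ≤ μ * abar := mul_le_mul_of_nonneg_left (hrelA.le.trans (hA₁A.trans hA₁abar)) hμ0
    have h2 : μ * abar ≤ gz := by
      rw [hI, hgzdef]
      calc (1 - κ) * γD ≤ 1 * γD := mul_le_mul_of_nonneg_right (by linarith) (by linarith)
        _ = γD := one_mul _
        _ ≤ γD * zP := le_mul_of_one_le_right (by linarith) hz
    linarith
  -- F(w*) ≥ 0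
  have hFs : 0 ≤ (gz - μ * G) * (abar - G * (1 + κ * (ws - 1))) - lam * gz * (q - m * ws) := by
    rw [h0, mul_zero, sub_zero]
    exact mul_nonneg hgzμG (sub_nonneg.2 hGαs)
  -- F is affine in w' with slope `sl`; F(1), F(w*) ≥ 0 and 1 ≤ w < w* give F(w) ≥ 0
  rw [hL1] at hF1
  set sl := -(gz - μ * G) * (G * κ) + lam * gz * m with hsl
  have hFw : (gz - μ * G) * (abar - G * (1 + κ * (w - 1))) - lam * gz * (q - m * w) =
      ((gz - μ * G) * (abar - G) - lam * gz * (q - m * 1)) + sl * (w - 1) := by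
    rw [hsl]; ring
  have hFws : (gz - μ * G) * (abar - G * (1 + κ * (ws - 1))) - lam * gz * (q - m * ws) =
      ((gz - μ * G) * (abar - G) - lam * gz * (q - m * 1)) + sl * (ws - 1) := by
    rw [hsl]; ring
  have goal : 0 ≤ (gz - μ * G) * (abar - G * (1 + κ * (w - 1))) - lam * gz * (q - m * w) := by
    rcases le_or_gt 0 sl with hsl0 | hsl0
    · rw [hFw]
      have := mul_nonneg hsl0 (sub_nonneg.2 hw)
      linarith
    · rw [hFws] at hFs
      rw [hFw]
      have : sl * (ws - 1) ≤ sl * (w - 1) := by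
        have := mul_le_mul_of_nonpos_left (sub_le_sub_right hws_w.le 1) hsl0.le
        linarith
      linarith
  rw [← hLw] at goal
  linarith

/-- **★ᵣ from (HCᵣ).**  Abstract form (compare `star_of_hc`): state `(A, G)` with `A ≤ ᾱ`, last petal `(w, z, w)` with
`1 ≤ w ≤ z`, `α_r = 1 + κ(w−1) ≤ γ_r = λw + μz`; budgets `Gγ_r ≤ Y`, `gz·z ≤ Y`; `ᾱμ ≤ gz`, `1 ≤ gz`; the x-room facts
`A·α_r ≤ ᾱ`, `A·w ≤ ᾱ + (1−κ)(w−1)`; and (HCᵣ) in the regime `gz < G < A`.  Then `A·γ_r + G·α_r ≤ ᾱ + Y`. [this work] -/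
theorem star_r_of_hcr {A G gz w z μ lam κ abar Y : ℝ} (hμ0 : 0 ≤ μ) (hlμ : lam + μ = 1) (hκ0 : 0 ≤ κ) (hκ1 : κ ≤ 1)
    (hw : 1 ≤ w)
    (hwz : w ≤ z) (hgz1 : 1 ≤ gz) (hA : A ≤ abar) (hAa : A * (1 + κ * (w - 1)) ≤ abar)
    (hAw : A * w ≤ abar + (1 - κ) * (w - 1)) (hαγ : 1 + κ * (w - 1) ≤ lam * w + μ * z)
    (hbud : G * (lam * w + μ * z) ≤ Y) (hzY : gz * z ≤ Y) (hI : abar * μ ≤ gz)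
    (hHCr : gz < G → G < A → lam * gz * w * (A - G) ≤ (gz - μ * G) * (abar - G * (1 + κ * (w - 1)))) :
    A * (lam * w + μ * z) + G * (1 + κ * (w - 1)) ≤ abar + Y := by
  have hμA : μ * A ≤ gz := by linarith [mul_le_mul_of_nonneg_left hA hμ0]
  rcases le_or_gt A G with hAG | hAG
  · -- aligned state
    have h1 : A * (lam * w + μ * z) + G * (1 + κ * (w - 1)) ≤ A * (1 + κ * (w - 1)) + G * (lam * w + μ * z) := by
      linarith [mul_nonneg (sub_nonneg.2 hAG) (sub_nonneg.2 hαγ)]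
    linarith
  rcases le_or_gt G gz with hGz | hGz
  · -- `G ≤ gz`: the vv-budget pays
    have h1 : w * (gz - μ * A) ≤ z * (gz - μ * A) := mul_le_mul_of_nonneg_right hwz (by linarith)
    have hαr0 : 0 ≤ 1 + κ * (w - 1) := by have := mul_nonneg hκ0 (sub_nonneg.2 hw); linarith
    have h2 : G * (1 + κ * (w - 1)) ≤ gz * (1 + κ * (w - 1)) := mul_le_mul_of_nonneg_right hGz hαr0
    have h3 : 0 ≤ (1 - κ) * (w - 1) * (gz - 1) := mul_nonneg (mul_nonneg (by linarith) (by linarith)) (by linarith)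
    have hlam : lam = 1 - μ := by linarith
    rw [hlam]
    linarith
  · -- the hard case: convex combination with weight `τ`
    have hH := hHCr hGz hAG
    have hden : 0 < gz - μ * G := by
      rcases eq_or_lt_of_le hμ0 with hμ00 | hμpos
      · rw [← hμ00]; linarith
      · linarith [mul_lt_mul_of_pos_left hAG hμpos]
    obtain ⟨τ, hτ⟩ : ∃ τ : ℝ, τ = μ * (A - G) / (gz - μ * G) := ⟨_, rfl⟩
    have hτ0 : 0 ≤ τ := by rw [hτ]; exact div_nonneg (mul_nonneg hμ0 (sub_nonneg.2 hAG.le)) hden.le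
    have hτden : τ * (gz - μ * G) = μ * (A - G) := by rw [hτ]; exact div_mul_cancel₀ _ hden.ne'
    have hτ1 : τ ≤ 1 := by rw [hτ, div_le_one hden]; linarith
    -- Y ≥ (1−τ)·Gγ_r + τ·gz·z
    have hY : (1 - τ) * (G * (lam * w + μ * z)) + τ * (gz * z) ≤ Y := by
      have h1 := mul_le_mul_of_nonneg_left hbud (sub_nonneg.2 hτ1)
      have h2 := mul_le_mul_of_nonneg_left hzY hτ0
      linarith
    -- the constant part: λw(A−G) + λwτG + Gα_r ≤ ᾱ, from (HCᵣ) after multiplying by gz − μG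
    have hconst : lam * w * (A - G) + lam * w * τ * G + G * (1 + κ * (w - 1)) ≤ abar := by
      have h1 : (lam * w * (A - G) + lam * w * τ * G + G * (1 + κ * (w - 1))) * (gz - μ * G) =
          lam * gz * w * (A - G) - (gz - μ * G) * (abar - G * (1 + κ * (w - 1))) + abar * (gz - μ * G) := by
        have e : lam * w * τ * G * (gz - μ * G) = lam * w * G * (τ * (gz - μ * G)) := by ring
        calc (lam * w * (A - G) + lam * w * τ * G + G * (1 + κ * (w - 1))) * (gz - μ * G)
            = lam * w * (A - G) * (gz - μ * G) + lam * w * G * (τ * (gz - μ * G)) +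
                G * (1 + κ * (w - 1)) * (gz - μ * G) := by ring
          _ = _ := by rw [hτden]; ring
      have h2 : (lam * w * (A - G) + lam * w * τ * G + G * (1 + κ * (w - 1))) * (gz - μ * G) ≤
          abar * (gz - μ * G) := by rw [h1]; linarith
      exact le_of_mul_le_mul_right h2 hden
    -- the z-terms cancel by the choice of τ
    have hfinal : abar + ((1 - τ) * (G * (lam * w + μ * z)) + τ * (gz * z)) -
        (A * (lam * w + μ * z) + G * (1 + κ * (w - 1))) =
        (abar - (lam * w * (A - G) + lam * w * τ * G + G * (1 + κ * (w - 1)))) +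
          z * (τ * (gz - μ * G) - μ * (A - G)) := by ring
    have : 0 ≤ abar + ((1 - τ) * (G * (lam * w + μ * z)) + τ * (gz * z)) -
        (A * (lam * w + μ * z) + G * (1 + κ * (w - 1))) := by
      rw [hfinal, hτden, sub_self, mul_zero, add_zero]
      linarith
    linarith

end LinkedCurrency

end SafeCalc

end Summit.CriticalPhenomena.PercolationContinuityZ3.Theorems.SunflowerPartition
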